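import Summits.KontsevichZagierPeriods.Zeta5Search.WedgeDictionaryCoeffV
import HarnessLib

/-!
# Level descent on the face `b₁ = b₂ = N/2`: the `ζ(5)`-free wedge is one degenerate dual series (cell `pub-zeta5`, P1)

HONEST FRAMING: systematic search; no irrationality claim unless certified.

OUR work (Summit side, P1 seat generation 4), the face case `c₁₂ = N − b₁ − b₂ = 0` of planner gen-1 g6's OBSERVED
"level descent at the same level" (memo `pub-zeta5-gen-1/D2-PPART-MECHANISM-g6.md` §0.2, §4.1; conjecture staged as
`levelDescentW/V`, not yet in the tree).  On the box `2b_j ≤ N`, `c₁₂ = 0` forces `b₁ = b₂ = N/2`; then the two slots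
`(X)_{N/2}(X+N/2+1)_{N/2} = (X)_{N+1}/(X+N/2)` turn the numerator into
`numPoly_b · (X + N/2)² = numPoly(N; N+1, 0, b₃,…,b₇)` (`numPoly_faceShape`) — the DEGENERATE shape `b♭ = (N; N+1, 0, b₃,…,b₇)`
(allowed by `InBox`), a `ζ(5)`-free ("level-5") series: `(X)_{N+1}² ∣ numPoly b♭`, so `U(b♭) = 0` (`coeffU_eq_zero_of_sq_dvd`,
the mechanism of gen-1 g4's `quadM3_eq_zero_of_pair`).  Since `numPoly(b+e_j) = (X+b_j)(X+N−b_j)·numPoly b` and `2b₁ = N`,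
`numPoly b♭ = numPoly(b+e_j) + (b₁² − b_j(N−b_j))·numPoly b` EXACTLY, a summable combination with zero telescoper; hence
(`coeff_rel_of_summable`, `coeffV_rel_of_summable4`) for `X ∈ {U, W, V}`: `X(b♭) = X(b+e_j) + (b₁² − b_j(N−b_j))·X(b)`.
THEOREMS (`levelDescent_face`), for `j ∈ {3,…,7}`, `b_j ≤ N`, `d(b) ≥ 0`, `b₁ ≥ 1`:
* `U(b+e_j) = (b_j(N−b_j) − b₁²)·U(b)`  (the `ζ(5)`-freeness of the wedge, as a recursion for `U` along the face);
* `U(b)·W(b+e_j) − U(b+e_j)·W(b) = U(b)·W(b♭)` and `U(b)·V(b+e_j) − U(b+e_j)·V(b) = U(b)·V(b♭)` — the face case of (LD@N-W/V)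
  with the weight `Ω₀ = U(b)` (gen-1 g6 observed `Ω₀(b) = U(b)` 60/60; the closed factorial form of `U` on this face is NOT proved here).
No irrationality content: identities between rational partial-fraction coefficients.
-/

open Finset Polynomial

namespace Summit.KontsevichZagierPeriods.Zeta5Search.WedgeDictionary

open Summit.KontsevichZagierPeriods.Zeta5Search.DualSeries
open Literature.NumberTheory.Transcendental (BallRivoal.poch)
open Literature.NumberTheory.Transcendental.BallRivoal (pochPoly eval_pochPoly pfEval)
open Literature.NumberTheory.Irrationality.CressonFischlerRivoal2008 (exists_pf_data)

namespace LevelDescent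

/-! ### A `ζ(5)`-free numerator: `(X)_{N+1}² ∣ numPoly b ⇒ U(b) = 0` -/

/-- **Pole-order drop** (the mechanism of `quadM3_eq_zero_of_pair`, isolated): if `(X)_{b₀+1}² ∣ numPoly b` for `b` in the box
with `Σ_j b_j ≤ 3b₀ + 1`, then `R_b` has poles of order `≤ 4` only and `U(b) = 0`. -/
theorem coeffU_eq_zero_of_sq_dvd (b : ℕ → ℤ) (hb : InBox b) (hsum : ∑ j ∈ range 7, b (j + 1) ≤ 3 * b 0 + 1)
    (hdvd : pochPoly 0 ((b 0).toNat + 1) ^ 2 ∣ numPoly b) : coeffU b = 0 := by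
  set B := (b 0).toNat with hBdef
  obtain ⟨M, hM⟩ := hdvd
  have hq : (pochPoly 0 (B + 1)).Monic := by
    unfold pochPoly; exact monic_prod_of_monic _ _ fun s _ => monic_X_add_C _
  have hqdeg : (pochPoly 0 (B + 1)).natDegree = B + 1 := by
    unfold pochPoly
    rw [natDegree_prod_of_monic _ _ fun s _ => monic_X_add_C _]
    simp only [natDegree_X_add_C, sum_const, card_range, smul_eq_mul, mul_one]
  have hdegN := natDegree_numPoly_add_two_le b hb hsum
  have hMdeg : (M.comp (X + C 1)).degree < ((4 * (B + 1) : ℕ) : WithBot ℕ) := by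
    by_cases hM0 : M = 0
    · rw [hM0, zero_comp, degree_zero]; exact WithBot.bot_lt_coe _
    · have hq0 : pochPoly 0 (B + 1) ^ 2 ≠ 0 := pow_ne_zero _ hq.ne_zero
      have hdegM : (numPoly b).natDegree = 2 * (B + 1) + M.natDegree := by
        rw [hM, natDegree_mul hq0 hM0, natDegree_pow, hqdeg]
      have hnat : (M.comp (X + C 1)).natDegree = M.natDegree := by
        rw [natDegree_comp, natDegree_X_add_C, mul_one]
      exact degree_le_natDegree.trans_lt (by rw [hnat]; exact_mod_cast (by omega))
  obtain ⟨c4, hc4⟩ := exists_pf_data B 4 (by norm_num) _ hMdeg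
  set c6 : ℕ → ℕ → ℚ := fun o p => if o < 4 then c4 o p else 0 with hc6def
  have hc6 : IsPFData b c6 := by
    intro t ht
    have hpoch : BallRivoal.poch (t + 1) (B + 1) ≠ 0 := by
      unfold BallRivoal.poch
      exact prod_ne_zero_iff.2 fun s hs h => ht s (Nat.lt_succ_iff.1 (mem_range.1 hs)) (by linarith)
    have h64 : pfEval B 6 c6 t = pfEval B 4 c4 t := by
      unfold pfEval
      refine sum_congr rfl fun p _ => ?_
      rw [sum_range_succ, sum_range_succ]
      simp only [hc6def, show ¬ (4:ℕ) < 4 by norm_num, show ¬ (5:ℕ) < 4 by norm_num, if_false, zero_div, add_zero]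
      exact sum_congr rfl fun o ho => by rw [if_pos (mem_range.1 ho)]
    rw [h64, hc4 t ht, hM]
    simp only [eval_comp, eval_mul, eval_pow, eval_add, eval_X, eval_C, eval_pochPoly, add_zero]
    rw [div_eq_div_iff (pow_ne_zero _ hpoch) (pow_ne_zero _ hpoch)]
    ring
  rw [coeffU_eq hc6]
  exact sum_eq_zero fun p _ => by simp [hc6def]

/-! ### The face `b₁ = b₂ = N/2` and its degenerate shape -/

/-- `(X)_{m+n} = (X)_m · (X+m)_n`. -/
theorem pochPoly_zero_add (m n : ℕ) : pochPoly 0 (m + n) = pochPoly 0 m * pochPoly (m : ℚ) n := by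
  induction n with
  | zero => simp [pochPoly]
  | succ n ih =>
    rw [show m + (n + 1) = (m + n) + 1 by ring, pochPoly_zero_succ, ih]
    unfold pochPoly
    rw [prod_range_succ]
    push_cast
    ring

/-- The degenerate shape of the face: `b♭ = (N; N+1, 0, b₃, b₄, b₅, b₆, b₇)`. -/
def faceShape (b : ℕ → ℤ) : ℕ → ℤ := Function.update (Function.update b 1 (b 0 + 1)) 2 0

/-- Values of `b♭`. -/
theorem faceShape_apply (b : ℕ → ℤ) (k : ℕ) :
    faceShape b k = if k = 2 then 0 else if k = 1 then b 0 + 1 else b k := by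
  unfold faceShape
  by_cases h2 : k = 2
  · subst h2; simp
  · by_cases h1 : k = 1
    · subst h1; simp
    · simp [h1, h2]

/-- **The numerator identity of the face**: for `b₁ = b₂`, `2b₁ = N`: `numPoly b♭ = numPoly b · (X + b₁)²`. -/
theorem numPoly_faceShape (b : ℕ → ℤ) (h0 : 0 ≤ b 0) (h12 : b 2 = b 1) (h11 : 2 * b 1 = b 0) :
    numPoly (faceShape b) = numPoly b * (X + C (b 1 : ℚ)) ^ 2 := by
  have hβ0 : 0 ≤ b 1 := by omega
  set β := (b 1).toNat with hβ
  have hβz : ((β : ℕ) : ℤ) = b 1 := Int.toNat_of_nonneg hβ0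
  have hN : (b 0).toNat = β + β := by omega
  have hN1 : (b 0 + 1).toNat = (β + β) + 1 := by omega
  -- the two special slots
  have hslot : pochPoly 0 β * pochPoly ((b 0 - b 1 + 1 : ℤ) : ℚ) β * (X + C (b 1 : ℚ)) = pochPoly 0 ((β + β) + 1) := by
    rw [show β + β + 1 = β + (β + 1) by ring, pochPoly_zero_add β (β + 1), pochPoly_succ_left]
    have e : ((b 0 - b 1 + 1 : ℤ) : ℚ) = (β : ℚ) + 1 := by
      have : (b 0 - b 1 + 1 : ℤ) = (β : ℤ) + 1 := by omega
      rw [this]; push_cast; ring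
    have e' : ((b 1 : ℤ) : ℚ) = (β : ℚ) := by rw [← hβz]; norm_cast
    rw [e, e']
    ring
  have hF0 : faceShape b 0 = b 0 := by rw [faceShape_apply]; simp
  have hF1 : faceShape b (0 + 1) = b 0 + 1 := by rw [faceShape_apply]; simp
  have hF2 : faceShape b (1 + 1) = 0 := by rw [faceShape_apply]; simp
  unfold numPoly
  rw [hF0]
  -- split off slots 1 and 2 (indices 0 and 1 of `range 7`) on both sides
  have hsplit : ∀ F : ℕ → ℚ[X], ∏ j ∈ range 7, F j = F 0 * F (0 + 1) * ∏ k ∈ range 5, F (k + 1 + 1) := by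
    intro F
    rw [prod_range_succ' _ 6, prod_range_succ' _ 5]
    ring
  rw [hsplit, hsplit (fun j => pochPoly 0 (b (j + 1)).toNat * pochPoly ((b 0 - b (j + 1) + 1 : ℤ) : ℚ) (b (j + 1)).toNat)]
  have hrest : ∏ k ∈ range 5, pochPoly 0 (faceShape b (k + 1 + 1 + 1)).toNat *
        pochPoly ((b 0 - faceShape b (k + 1 + 1 + 1) + 1 : ℤ) : ℚ) (faceShape b (k + 1 + 1 + 1)).toNat =
      ∏ k ∈ range 5, pochPoly 0 (b (k + 1 + 1 + 1)).toNat *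
        pochPoly ((b 0 - b (k + 1 + 1 + 1) + 1 : ℤ) : ℚ) (b (k + 1 + 1 + 1)).toNat := by
    refine prod_congr rfl fun k _ => ?_
    rw [faceShape_apply, if_neg (by omega), if_neg (by omega)]
  rw [hrest, hF1, hF2, hN1, show ((0 : ℤ)).toNat = 0 from rfl, show b (1 + 1) = b 1 from h12,
    show (b 1).toNat = β from rfl, show b (0 + 1) = b 1 from rfl]
  have e1 : ((b 0 - (b 0 + 1) + 1 : ℤ) : ℚ) = 0 := by push_cast; ring
  rw [e1, ← hslot]
  simp [pochPoly]
  ring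

/-- `b♭` lies in the box, at level `N`, with `Σ_j b♭_j = Σ_j b_j + 1`. -/
theorem faceShape_box (b : ℕ → ℤ) (hb : InBox b) (h12 : b 2 = b 1) (h11 : 2 * b 1 = b 0) :
    InBox (faceShape b) ∧ faceShape b 0 = b 0 ∧
      ∑ j ∈ range 7, faceShape b (j + 1) = (∑ j ∈ range 7, b (j + 1)) + 1 := by
  have hv : ∀ k, faceShape b k = if k = 2 then 0 else if k = 1 then b 0 + 1 else b k := faceShape_apply b
  have hF0 : faceShape b 0 = b 0 := by rw [hv]; simp
  refine ⟨⟨by rw [hF0]; exact hb.1, fun j hj => ?_⟩, hF0, ?_⟩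
  · rw [hF0, hv]
    have hj' := mem_range.1 hj
    have h0 := hb.1
    by_cases h2 : j + 1 = 2
    · rw [if_pos h2]; omega
    · rw [if_neg h2]
      by_cases h1 : j + 1 = 1
      · rw [if_pos h1]; omega
      · rw [if_neg h1]; exact hb.2 j hj
  · simp only [sum_range_succ, sum_range_zero, hv]
    norm_num
    omega

/-- **Level descent on the face `b₁ = b₂ = N/2`** (gen-1 g6's (LD@N) at `c₁₂ = 0`, with the weight `Ω₀ = U(b)`):
for `j ∈ {3,…,7}` with `b_j ≤ N`, `d(b) ≥ 0`, `b₁ ≥ 1`, writing `b′ = b + e_j` and `b♭ = (N; N+1, 0, b₃,…,b₇)`: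
`U(b♭) = 0`, `U(b′) = (b_j(N−b_j) − b₁²)·U(b)`, `U(b)W(b′) − U(b′)W(b) = U(b)·W(b♭)`, `U(b)V(b′) − U(b′)V(b) = U(b)·V(b♭)`. -/
theorem levelDescent_face (b : ℕ → ℤ) (hb : InBox b) (h12 : b 2 = b 1) (h11 : 2 * b 1 = b 0) (h1 : 1 ≤ b 1)
    (hd : 0 ≤ dOf b) {j : ℕ} (hj : j ∈ Icc 3 7) (hjN : b j ≤ b 0) :
    coeffU (faceShape b) = 0 ∧
    coeffU (Function.update b j (b j + 1)) = ((b j : ℚ) * ((b 0 : ℚ) - b j) - (b 1 : ℚ) ^ 2) * coeffU b ∧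
    coeffU b * coeffW (Function.update b j (b j + 1)) - coeffU (Function.update b j (b j + 1)) * coeffW b =
      coeffU b * coeffW (faceShape b) ∧
    coeffU b * coeffV (Function.update b j (b j + 1)) - coeffU (Function.update b j (b j + 1)) * coeffV b =
      coeffU b * coeffV (faceShape b) := by
  obtain ⟨hj3, hj7⟩ := mem_Icc.1 hj
  obtain ⟨i, rfl⟩ : ∃ i, j = i + 1 := ⟨j - 1, by omega⟩
  have hi7 : i ∈ range 7 := mem_range.2 (by omega)
  have hβ0 : 0 ≤ b (i + 1) := (hb.2 i hi7).1
  have hN : 1 ≤ (b 0).toNat := by omega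
  obtain ⟨hbF, hF0, hFsum⟩ := faceShape_box b hb h12 h11
  have hs : ∑ j ∈ range 7, b (j + 1) ≤ 3 * b 0 + 1 := sum_le_of_dOf b hd
  have hsF : ∑ j ∈ range 7, faceShape b (j + 1) ≤ 3 * faceShape b 0 + 1 := by
    rw [hFsum, hF0]; unfold dOf at hd; omega
  obtain ⟨hb', hs'⟩ := box_update b hb hd hi7 hjN
  -- the exact three-term numerator identity (zero telescoper)
  set κ : ℚ := (b 1 : ℚ) ^ 2 - (b (i + 1) : ℚ) * ((b 0 : ℚ) - b (i + 1)) with hκ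
  have e1 : numPoly (Function.update b (i + 1) (b (i + 1) + 1)) =
      numPoly b * ((X + C (b (i + 1) : ℚ)) * (X + C ((b 0 - b (i + 1) : ℤ) : ℚ))) := numPoly_update b hi7 hβ0
  have e2 := numPoly_faceShape b hb.1 h12 h11
  have h2b : (2 : ℚ) * (b 1 : ℚ) = (b 0 : ℚ) := by exact_mod_cast h11
  have hrel : C (1 : ℚ) * numPoly (faceShape b) + C (-1 : ℚ) * numPoly (Function.update b (i + 1) (b (i + 1) + 1)) +
      C (-κ) * numPoly b = (0 : ℚ[X]).comp (X + C 1) * X ^ 6 - 0 * (X + C (((b 0).toNat : ℕ) : ℚ)) ^ 6 := by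
    rw [e1, e2, zero_comp, zero_mul, zero_mul, sub_zero, hκ]
    simp only [Int.cast_sub, map_sub, map_mul, map_neg, map_one, map_pow]
    have hC : C (b 0 : ℚ) = 2 * C (b 1 : ℚ) := by rw [← h2b, map_mul, map_ofNat]
    rw [hC]
    ring
  have hg : (0 : ℚ[X]).natDegree + 1 ≤ 6 * (b 0).toNat := by rw [natDegree_zero]; omega
  obtain ⟨hU, hW⟩ := coeff_rel_of_summable (faceShape b) (Function.update b (i + 1) (b (i + 1) + 1)) b (b 0).toNat hN
    hbF hb' hb hsF hs' hs (by rw [hF0]) (by rw [Function.update_of_ne (by omega)]) rfl 1 (-1) (-κ) 0 hg hrel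
  have hV := coeffV_rel_of_summable4 (faceShape b) (Function.update b (i + 1) (b (i + 1) + 1)) b b (b 0).toNat hN
    hbF hb' hb hb hsF hs' hs hs (by rw [hF0]) (by rw [Function.update_of_ne (by omega)]) rfl rfl 1 (-1) (-κ) 0 0 hg
    (by rw [map_zero, zero_mul, add_zero]; exact hrel)
  rw [eval_zero, zero_div] at hV
  -- U of the degenerate shape vanishes: (X)_{N+1}² ∣ numPoly b♭
  have hU0 : coeffU (faceShape b) = 0 := by
    refine coeffU_eq_zero_of_sq_dvd (faceShape b) hbF hsF ?_
    have h01 : (0 : ℕ) ∈ range 7 := mem_range.2 (by norm_num)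
    have hslot1 : pochPoly 0 (faceShape b (0 + 1)).toNat *
        pochPoly ((faceShape b 0 - faceShape b (0 + 1) + 1 : ℤ) : ℚ) (faceShape b (0 + 1)).toNat =
        pochPoly 0 ((faceShape b 0).toNat + 1) ^ 2 := by
      rw [show faceShape b (0 + 1) = b 0 + 1 by rw [faceShape_apply]; simp, hF0,
        show (b 0 + 1).toNat = (b 0).toNat + 1 by have := hb.1; omega,
        show ((b 0 - (b 0 + 1) + 1 : ℤ) : ℚ) = 0 by push_cast; ring, pow_two]
    unfold numPoly
    refine Dvd.dvd.mul_left ?_ _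
    rw [← hslot1]
    exact dvd_prod_of_mem _ h01
  refine ⟨hU0, ?_, ?_, ?_⟩
  · rw [hκ] at hU
    linear_combination -hU + hU0
  · linear_combination (-coeffU b) * hW + coeffW b * hU + (-coeffW b) * hU0
  · linear_combination (-coeffU b) * hV + coeffV b * hU + (-coeffV b) * hU0

/-- **Every degenerate shape is `ζ(5)`-free**: if the first slot is `N + 1` (so `(X)_{N+1}² ∣ numPoly b`), then
`U(b) = 0` — in particular for all of gen-1 g6's shapes `degShape b i = (N; N+1, 0, b₃, b₄, b₅, b₆, b₇ − i)`
(the `coeffU_degShape = 0` clause of the lead's T1 ruling), for `b` in the box with `Σ_j b_j ≤ 3N + 1`. -/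
theorem coeffU_eq_zero_of_slot_one (b : ℕ → ℤ) (hb : InBox b) (hsum : ∑ j ∈ range 7, b (j + 1) ≤ 3 * b 0 + 1)
    (h1 : b 1 = b 0 + 1) : coeffU b = 0 := by
  refine coeffU_eq_zero_of_sq_dvd b hb hsum ?_
  have h01 : (0 : ℕ) ∈ range 7 := mem_range.2 (by norm_num)
  have hslot1 : pochPoly 0 (b (0 + 1)).toNat * pochPoly ((b 0 - b (0 + 1) + 1 : ℤ) : ℚ) (b (0 + 1)).toNat =
      pochPoly 0 ((b 0).toNat + 1) ^ 2 := by
    rw [show b (0 + 1) = b 0 + 1 from h1, show (b 0 + 1).toNat = (b 0).toNat + 1 by have := hb.1; omega,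
      show ((b 0 - (b 0 + 1) + 1 : ℤ) : ℚ) = 0 by push_cast; ring, pow_two]
  unfold numPoly
  refine Dvd.dvd.mul_left ?_ _
  rw [← hslot1]
  exact dvd_prod_of_mem _ h01

end LevelDescent

end Summit.KontsevichZagierPeriods.Zeta5Search.WedgeDictionary
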